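import Literature.AlgebraicGeometry.Resolution.KollarBoundarySeparationTameSurfaceAll
import Literature.AlgebraicGeometry.Resolution.KollarSurfaceOrderReductionTameCurvePartBoundary
import Literature.AlgebraicGeometry.Resolution.KollarSurfaceOrderReductionTameGlobalBoundary
import HarnessLib

/-!
# Order reduction for marked ideals on surfaces in the tame regime `ord < p`, with a simple normal crossing boundary — the global theorem (Kollár 2007, Thm. 3.69 in dimension two)

Topic: `Literature/AlgebraicGeometry/Resolution`. J. Kollár, *Lectures on Resolution of
Singularities* (2007), Thm. 3.69 (order reduction for marked ideals `(X, I, m, E)`, p. 150 of the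
held copy) in dimension two and characteristic `p > max-ord`, following Kollár's own steps:
Lemma 3.102 for every member of `E` (3.103 Step 1 / 3.104 Step 2.1: the cosupport is moved off
the old boundary, `KollarBoundarySeparationTameSurfaceAll.lean`), 3.111 Step 1 (the curve part of
the cosupport is blown up, `KollarSurfaceOrderReductionTameCurvePartBoundary.lean`), 3.104 Step
2.2 at the finitely many remaining points with 3.105 (glued local order reductions by maximal
contact and dimension induction, `KollarSurfaceOrderReductionTameGlobalBoundary.lean`), the
maximal-contact charts being the birational transforms of those of Thm. 3.80 at the image points
(`MaximalContactChartsTransport.lean`) and the old boundary members, disjoint from the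
cosupport, being dropped and restored (`CentreSeq.IsResolutionOf.of_dominated`).
`KollarSurfaceOrderReductionTameSurface.lean` is the case `E = ∅`.

* **`Kollar2007.exists_isResolutionOf_boundary_of_topologicalKrullDim_le_two`** — `X` smooth over
  a perfect field `k` of characteristic `p` (`p = 0` allowed), Noetherian of dimension `≤ 2`,
  `(I, E, b)` a marked ideal with `E` a simple normal crossing boundary, `max-ord I ≤ b`,
  `1 ≤ b < p` ⟹ a smooth blow-up sequence RESOLVING `(X, I, E, b)` (BGMW Def. 3.1.3: regular
  centres inside the successive cosupports with simple normal crossings with the successive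
  boundaries, final cosupport empty).

## Sources

* J. Kollár, *Lectures on Resolution of Singularities*, Ann. of Math. Stud. 166 (2007):
  Thm. 3.69, 3.70, Lemma 3.102, Thm. 3.103–3.105, 3.111 (pp. 150–176). [Kollar2007]
* E. Bierstone, D. Grigoriev, P. Milman, J. Włodarczyk, arXiv:1206.3090: Def. 3.1.3,
  Thm. 8.0.4. [BierstoneGrigorievMilmanWlodarczyk2011]
-/

noncomputable section

open CategoryTheory CategoryTheory.Limits AlgebraicGeometry TopologicalSpace IsLocalRing
  Scheme.IdealSheafData

namespace Literature.AlgebraicGeometry.Resolution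

universe u

namespace Kollar2007

variable (k : Type u) [Field k] (X : Scheme.{u}) [X.Over (Spec (.of k))]

/-- **Order reduction for marked ideals on surfaces in the tame regime, with a simple normal
crossing boundary — Kollár's Thm. 3.69 in dimension two for `p > max-ord`.** Let `X` be smooth
over a perfect field `k` of characteristic `p` (`p = 0` allowed), Noetherian, of dimension `≤ 2`,
and `(I, E, b)` a marked ideal with `E` a simple normal crossing boundary, `max-ord I ≤ b`,
`1 ≤ b` and `p = 0 ∨ b < p`. Then there is a smooth blow-up sequence on `X` RESOLVING
`(X, I, E, b)` in the sense of BGMW Def. 3.1.3 (`CentreSeq.IsResolutionOf`). The sequence: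
Lemma 3.102 for every member of `E` (moving the cosupport off the old boundary), the blowing up
of the curve part of the cosupport (3.111 Step 1), and the glued local order reductions at the
finitely many remaining points (3.104 Step 2.2 with going up, 3.105) — the characteristic-zero
algorithm, valid because maximal contact and going up hold for `ord < p` (BGMW Thm. 8.0.4).
[cite: Kollar2007, Thm. 3.69, 3.70, Lemma 3.102, Thm. 3.103, 3.104, Thm. 3.105, 3.111]
[cite: BierstoneGrigorievMilmanWlodarczyk2011, Def. 3.1.3, Thm. 8.0.4] -/
theorem exists_isResolutionOf_boundary_of_topologicalKrullDim_le_two (p : ℕ) [CharP k p]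
    [PerfectField k] [Smooth (X ↘ Spec (.of k))] [NoetherianSpace X]
    (hX2 : topologicalKrullDim X ≤ 2) (I : X.IdealSheafData) {E : List X.IdealSheafData}
    (hE : HasSNC E) {b : ℕ} (hb : 1 ≤ b) (hbp : p = 0 ∨ b < p)
    (hmax : ∀ x : X, idealOrder I x ≤ b) :
    ∃ s : CentreSeq X, s.IsResolutionOf ⟨I, E, b⟩ := by
  classical
  haveI : IsLocallyNoetherian X := isLocallyNoetherian_of_locallyOfFiniteType_over k X
  have hXreg : Scheme.IsRegular X := Scheme.isRegular_of_smooth_over_field k X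
  set M : MarkedIdeal X := ⟨I, E, b⟩ with hM
  -- Step 1 (Lemma 3.102 for every member): move the cosupport off the old boundary
  obtain ⟨t₁, ht₁, hsep⟩ := exists_separate_boundary k X p hX2 I hE hb hbp
  haveI : IsProper t₁.comp := t₁.isProper_comp
  haveI : IsLocallyNoetherian t₁.top := LocallyOfFiniteType.isLocallyNoetherian t₁.comp
  have hX₁reg : Scheme.IsRegular t₁.top :=
    (CentreSeq.IsAdmissibleFor.isMultipleBlowup t₁ M ht₁).isRegular hXreg
  letI : t₁.top.Over (Spec (.of k)) := ⟨t₁.comp ≫ X ↘ Spec (.of k)⟩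
  haveI : t₁.comp.IsOver (Spec (.of k)) := ⟨rfl⟩
  haveI : Smooth (t₁.top ↘ Spec (.of k)) := by
    have h : Smooth (t₁.comp ≫ X ↘ Spec (.of k)) := smooth_of_isRegular_of_perfectField _ hX₁reg
    exact h
  haveI : NoetherianSpace t₁.top := t₁.noetherianSpace_top
  have hX₁2 : topologicalKrullDim t₁.top ≤ 2 := t₁.topologicalKrullDim_top_le (N := 2) hX2
  have hφ₁ : t₁.comp.appTop.hom.comp (overHom k X) = overHom k t₁.top := appTop_comp_overHom k t₁.comp
  set M₁ : MarkedIdeal t₁.top := t₁.transformMarked M with hM₁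
  set I₁ := M₁.ideal with hI₁
  set E₁ := M₁.boundary with hE₁def
  set B₁ := t₁.exceptionalBoundary with hB₁def
  have hM₁eq : (⟨I₁, E₁, b⟩ : MarkedIdeal t₁.top) = M₁ := by
    rw [show b = M₁.mult from (CentreSeq.transformMarked_mult t₁ M).symm]
  have hmax₁ : ∀ y : t₁.top, idealOrder I₁ y ≤ b :=
    CentreSeq.IsAdmissibleFor.forall_idealOrder_transformMarked_le t₁ M hXreg ht₁ hmax
  have hE₁ : HasSNC E₁ := CentreSeq.IsAdmissibleFor.hasSNC_transformMarked_boundary t₁ M ht₁ hE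
  have hE₁eq : E₁ = E.map t₁.transformDivisor ++ B₁ := CentreSeq.transformMarked_boundary t₁ M
  have hB₁E₁ : ∀ D ∈ B₁, D ∈ E₁ := fun D hD => by rw [hE₁eq]; exact List.mem_append_right _ hD
  have hB₁ : HasSNC B₁ := HasSNC.of_subset hB₁E₁ hE₁
  have hsuppB₁ : (⟨I₁, B₁, b⟩ : MarkedIdeal t₁.top).support = M₁.support := by
    rw [MarkedIdeal.support_eq_support_of_boundary I₁ B₁ E₁ b, hM₁eq]
  -- the members through the cosupport are new
  have hdom₁ : ∀ x ∈ (⟨I₁, B₁, b⟩ : MarkedIdeal t₁.top).support, ∀ D ∈ E₁, x ∈ D.support → D ∈ B₁ := by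
    intro x hx D hD hxD
    rw [hE₁eq] at hD
    rcases List.mem_append.mp hD with hD | hD
    · obtain ⟨D₀, hD₀, rfl⟩ := List.mem_map.mp hD
      exfalso
      have h := hsep D₀ hD₀
      rw [hsuppB₁] at hx
      have : x ∈ ((t₁.transformDivisor D₀).support : Set t₁.top) ∩ M₁.support := ⟨hxD, hx⟩
      rw [h] at this
      exact this
    · exact hD
  -- maximal-contact charts: Thm. 3.80 at the points of `X`, transported along `t₁`
  have ht₁nil : t₁.IsAdmissibleFor ⟨I, [], b⟩ := CentreSeq.IsAdmissibleFor.of_nil_boundary hXreg t₁ ht₁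
  have hch₀ := fun x (_ : x ∈ (⟨I, [], b⟩ : MarkedIdeal X).support) => charts_of_tame k X p I hb hbp hmax x
  have hch₁ : ∀ y ∈ (⟨I₁, B₁, b⟩ : MarkedIdeal t₁.top).support, ∃ (V : Scheme.{u}) (j : V ⟶ t₁.top)
      (_ : IsOpenImmersion j) (_ : y ∈ Set.range j) (H : V.IdealSheafData),
      H ≤ derivIdealSheafIter (j.appTop.hom.comp (overHom k t₁.top)) (b - 1) (I₁.comap j) ∧
        (∀ v ∈ H.support, ∃ w : V.presheaf.stalk v,
          stalkIdeal H v = Ideal.span {w} ∧ w ∉ (maximalIdeal (V.presheaf.stalk v)) ^ 2) ∧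
        HasSNC (H :: B₁.map (·.comap j)) := by
    have h := charts_transformMarked k X I [] hb hch₀ t₁ ht₁nil
    have hid : (t₁.transformMarked ⟨I, [], b⟩).ideal = I₁ := by
      rw [hI₁, CentreSeq.transformMarked_ideal, CentreSeq.transformMarked_ideal]
    have hbd : (t₁.transformMarked ⟨I, [], b⟩).boundary = B₁ := by
      rw [CentreSeq.transformMarked_boundary, List.map_nil, List.nil_append]
    have hsp : (t₁.transformMarked ⟨I, [], b⟩).support = (⟨I₁, B₁, b⟩ : MarkedIdeal t₁.top).support := by
      unfold MarkedIdeal.support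
      rw [hid, CentreSeq.transformMarked_mult]
    rw [hφ₁, hid, hbd, hsp] at h
    exact h
  -- Step 2 (3.111 Step 1): blow up the curve part
  obtain ⟨P, hPadm, hfin₂, hcl₂, hdim₂⟩ :=
    curvePart_admissible_of_charts k t₁.top p hX₁2 I₁ (E := E₁) (B := B₁) hE₁ hb hbp hmax₁ hdom₁ hch₁
  haveI : IsLocallyNoetherian (blowup P) := CentreSeq.isLocallyNoetherian_blowup P
  haveI : IsProper (blowup.π P) := (blowup.isBlowup P).isProper
  obtain ⟨hPsupp, hPsncE, hPreg, -⟩ := hPadm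
  have hX₂reg : Scheme.IsRegular (blowup P) := (blowup.isBlowup P).isRegular_of_isRegular_subscheme hX₁reg hPreg
  letI : (blowup P).Over (Spec (.of k)) := ⟨blowup.π P ≫ t₁.top ↘ Spec (.of k)⟩
  haveI : (blowup.π P).IsOver (Spec (.of k)) := ⟨rfl⟩
  haveI : LocallyOfFiniteType ((blowup P) ↘ Spec (.of k)) :=
    inferInstanceAs (LocallyOfFiniteType (blowup.π P ≫ t₁.top ↘ Spec (.of k)))
  haveI : Smooth ((blowup P) ↘ Spec (.of k)) := smooth_of_isRegular_of_perfectField _ hX₂reg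
  have hφ₂ : (blowup.π P).appTop.hom.comp (overHom k t₁.top) = overHom k (blowup P) :=
    appTop_comp_overHom k (blowup.π P)
  set s : CentreSeq t₁.top := CentreSeq.cons P (CentreSeq.nil (blowup P)) with hsdef
  have hsE : s.IsAdmissibleFor ⟨I₁, E₁, b⟩ :=
    (CentreSeq.isAdmissibleFor_cons P _ _).mpr ⟨hPsupp, hPsncE, hPreg, trivial⟩
  have hsB : s.IsAdmissibleFor ⟨I₁, B₁, b⟩ :=
    CentreSeq.IsAdmissibleFor.of_dominated s hB₁ (fun _ _ D hD _ => hB₁E₁ D hD) hsE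
  set M₂ : MarkedIdeal (blowup P) := (⟨I₁, E₁, b⟩ : MarkedIdeal t₁.top).transform (blowup.π P) P with hM₂
  set N₂ : MarkedIdeal (blowup P) := (⟨I₁, B₁, b⟩ : MarkedIdeal t₁.top).transform (blowup.π P) P with hN₂
  have hI₂ : N₂.ideal = M₂.ideal := rfl
  have hE₂ : HasSNC M₂.boundary := MarkedIdeal.hasSNC_transform_boundary _ hPsncE (blowup.isBlowup P)
  have hB₂ : HasSNC N₂.boundary := MarkedIdeal.hasSNC_transform_boundary _ hsB.2.1 (blowup.isBlowup P)
  have hmax₂ : ∀ y : blowup P, idealOrder N₂.ideal y ≤ b :=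
    CentreSeq.IsAdmissibleFor.forall_idealOrder_transformMarked_le s ⟨I₁, B₁, b⟩ hX₁reg hsB hmax₁
  have hdom₂ : ∀ y ∈ (⟨N₂.ideal, N₂.boundary, b⟩ : MarkedIdeal (blowup P)).support,
      ∀ D ∈ M₂.boundary, y ∈ D.support → D ∈ N₂.boundary :=
    CentreSeq.dominated_transformMarked s hdom₁ hsB
  have hsupp₂ : (⟨N₂.ideal, N₂.boundary, b⟩ : MarkedIdeal (blowup P)).support = M₂.support := rfl
  have hfin₂' : (⟨N₂.ideal, N₂.boundary, b⟩ : MarkedIdeal (blowup P)).support.Finite := by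
    rw [hsupp₂]; exact hfin₂
  have hcl₂' : ∀ y ∈ (⟨N₂.ideal, N₂.boundary, b⟩ : MarkedIdeal (blowup P)).support,
      IsClosed ({y} : Set (blowup P)) := by
    rw [hsupp₂]; exact hcl₂
  have hdim₂' : ∀ y ∈ (⟨N₂.ideal, N₂.boundary, b⟩ : MarkedIdeal (blowup P)).support,
      ringKrullDim ((blowup P).presheaf.stalk y) ≤ 2 := by
    rw [hsupp₂]; exact hdim₂
  -- the charts transported along the blow-up of the curve part
  have hch₂ : ∀ y ∈ (⟨N₂.ideal, N₂.boundary, b⟩ : MarkedIdeal (blowup P)).support,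
      ∃ (V : Scheme.{u}) (j : V ⟶ blowup P) (_ : IsOpenImmersion j) (_ : y ∈ Set.range j)
        (H : V.IdealSheafData),
        H ≤ derivIdealSheafIter (j.appTop.hom.comp (overHom k (blowup P))) (b - 1) (N₂.ideal.comap j) ∧
          (∀ v ∈ H.support, ∃ w : V.presheaf.stalk v,
            stalkIdeal H v = Ideal.span {w} ∧ w ∉ (maximalIdeal (V.presheaf.stalk v)) ^ 2) ∧
          HasSNC (H :: N₂.boundary.map (·.comap j)) := by
    have h := charts_transformMarked k t₁.top I₁ B₁ hb hch₁ s hsB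
    have hφ₂' : s.comp.appTop.hom.comp (overHom k t₁.top) = overHom k (blowup P) := by
      change (𝟙 (blowup P) ≫ blowup.π P).appTop.hom.comp (overHom k t₁.top) = overHom k (blowup P)
      rw [Category.id_comp]
      exact hφ₂
    rw [hφ₂'] at h
    exact h
  -- Step 3 (3.104 Step 2.2 + 3.105): the finitely many remaining points
  obtain ⟨u, hu⟩ := exists_isResolutionOf_of_finite_support_charts k p _ (blowup P) N₂.ideal
    N₂.boundary hb hbp hmax₂ hB₂ hfin₂' hcl₂' hdim₂' hch₂ le_rfl
  -- Step 4: restore the old boundary members and concatenate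
  have huM₂ : u.IsResolutionOf M₂ := by
    have h := CentreSeq.IsResolutionOf.of_dominated u hE₂ hdom₂ hu
    exact h
  have h₁₂ : (s.append u).IsResolutionOf M₁ := by
    rw [← hM₁eq]
    exact hsE.append huM₂
  exact ⟨t₁.append (s.append u), ht₁.append h₁₂⟩

end Kollar2007

end Literature.AlgebraicGeometry.Resolution

end
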